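import Summits.Ventures.HodgeKum4.Theses.KummerFixedLocus
import Summits.Ventures.HodgeKum4.Theorems.KummerFixedLocusTangentDischarged
import HarnessLib

/-!
# Route KummerFixedLocus (`hodge-kum4`, rung H3) — item `Kum4FixedFourfoldHasFixedPointAtKummer` CLOSES in its print-antecedent form (kernel)

Seat p1 (g5).  Item stmt-Ventures-19595 restated by the planner (ruling (C-b′), director-hodge g7 2026-08-27; plan g18 route edit
2026-08-27T11:07:49Z, new item id stmt-Ventures-20383) to the
antecedent form whose leading binders are the REFEREED print facts its transcription consumes (Floccari–Varesco `Γ ≅ (ℤ/5)⁴`: `Hyperkaehler.FloccariVaresco2024_autFixingH2H3_equiv_kumType`; Oguiso 2020: `Hyperkaehler.Oguiso2020_fixedPointScheme_translation_generalizedKummerFour`): the route decl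
`Summit.Ventures.HodgeKum4.Theses.KummerFixedLocus.Kum4FixedFourfoldHasFixedPointAtKummer` then holds OUTRIGHT by seat p2's landed conditional closer
(`Theorems/KummerFixedLocusTangentDischarged.lean`), wrapped here (`unfold`; `exact`).  UNCONDITIONAL as typed (the print facts ARE the item's
hypotheses; axioms standard).  HONEST FRAMING: a print-input item of the route closes by transcription; nothing here says
`LefschetzGenerationKum4`, the point count, `HC_Kum4Type` or HC is proved, and no print fact is discharged.
-/

noncomputable section

namespace Summit.Ventures.HodgeKum4

/-- **Item stmt-Ventures-20383 (formerly 19595; kernel, by transcription)**: the route decl `Kum4FixedFourfoldHasFixedPointAtKummer` of `Theses.KummerFixedLocus` in its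
print-antecedent form holds, by `kum4FixedFourfoldHasFixedPointAtKummer_of_split`. -/
theorem kum4FixedFourfoldHasFixedPointAtKummer_holds :
    Summit.Ventures.HodgeKum4.Theses.KummerFixedLocus.Kum4FixedFourfoldHasFixedPointAtKummer := by
  unfold Summit.Ventures.HodgeKum4.Theses.KummerFixedLocus.Kum4FixedFourfoldHasFixedPointAtKummer
  exact fun hFV hOg ↦ kum4FixedFourfoldHasFixedPointAtKummer_of_split hFV hOg

end Summit.Ventures.HodgeKum4

end
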